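import Summits.Ventures.LatticeQCDFlow.Scaling.BooleanStarLipschitzPotential

/-!
HONEST FRAMING: exact (Metropolis-corrected) sampling algorithms for lattice gauge theory; figures
of merit are autocorrelation/cost numbers at stated couplings and volumes; no continuum-physics
claim.

# BooleanStarDefectCountLaw — AN UNCONDITIONAL COLD-START LAW FOR THE HOMOGENEOUS BOOLEAN STAR, ALL `K`:
# `t_mix(ε) ≤ ⌈(4/(hρ))·log((e·K+1)/ε)⌉₊`, `ρ = (3/4)·(t/K)·(p·h + rr·t)/(h+2t)²`, `h = (1−t)w_0`, `p = μ_0(b) + μ_0(b̄)·rr` (lean-2 GEN-32, ours)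

Venture-side (OURS).  Cell `lqcd-flow` (pub-lqcd), unit `pub-lqcd-lean-2-g32`, 2026-08-29.  Chapter S, file 8, on top of `BooleanStarLipschitzPotential` (S7).
S7 reduced OPEN-MATH item 1 (ii) for the homogeneous Boolean star (persistent hub, `K` idle cold levels with contents `Bool`, uniform entry list, exact hot
redraws) to ONE inequality, the redraw contraction `μ_0(b)·U(D,N) + μ_0(b̄)·V(D,N) ≤ (1−ρ)·Ψa(D,N)` for a potential `Ψa = 𝟙{D≥1}(D + φ(N) + φ(N+D))` and the exact
three-state class values `U, V` of S6.  This file DISCHARGES it for the simplest admissible choice `φ ≡ 0` — the plain cold defect count `Ψ = D·𝟙{D≥1}` — with the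
explicit rate `ρ = (3/4)·(t/K)·(p·h + rr·t)/(h+2t)²`, and so lands a mixing-time law for every `K` with no hypothesis beyond the model's standing assumptions.

The computation (§1): the class matrix is `h·1 + L` with `L` a zero-row-sum `Z`-matrix, so `det = h³ + h²·tr L + h·E₂(L)` (`threeState_det_expand`); `tr L ≤ 2(t+c)`
and `E₂(L) ≤ (tr L)²/3` give `3·det ≤ 4h(h+t+c)² ≤ 4h(h+2t)²` (`threeState_det_le_sharp`, `c = t/K ≤ t`) — the order `h·t²` of the determinant when swaps outpace
redraws, where the cruder `det ≤ p₁p₂p₃ ≍ t³` would lose a factor `h/t`.  For the data `(ψu, ψv, ψw) = (D, D, D−1)` of a class `(G, N, D)` the Cramer values of S6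
satisfy, by the row-sum identities, `D − u = h·C₁₃/det` and `D − v = h·C₂₃/det` with the third-column cofactors `C₁₃ = cD(h + rr(t+c))`, `C₂₃ = cD·rr·(h+t+c)`, whence
`D − u ≥ (3/4)·cD(h + rr·t)/(h+2t)²` and `D − v ≥ (3/4)·cD·rr·(h+t)/(h+2t)²` (`threeState_defect_gain`).  §2 feeds this into S7: at a configuration with `D ≥ 1` both redraw
classes (`(G, N, D)` for `U`, `(G−1, N+1, D)` for `V`) carry the data `(D, D, D−1)` (for `D = 1` the indicator makes `ψw = 0 = D − 1`), so the contraction holds with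
`ρ·D = (3/4)c·D·[μ_0(b)(h + rr·t) + μ_0(b̄)·rr·(h+t)] /(h+2t)² = (3/4)c·D·(p·h + rr·t)/(h+2t)²`; at `D = 0` everything vanishes; `Ψa ≤ K` on configurations and `0 < ρ ≤ 1`,
whence the law.

## What is proved

* §1 `threeState_det_expand`, **`threeState_det_le_sharp`** (`3·det ≤ 4h(h+t+c)²`) and **`threeState_defect_gain`** (`(3/4)cD(h+rr·t)/(h+2t)² ≤ D − u`,
  `(3/4)cD·rr(h+t)/(h+2t)² ≤ D − v` for the data `(D, D, D−1)`).
* §2 **`boolStar_defectCount_contr`** — the redraw contraction for `Ψ = D·𝟙{D≥1}` at every configuration, and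
  **`boolStar_mixingTime_le_allK`** — for the homogeneous Boolean star with `m ≥ 1` uniform entries, `0 < t < 1`, `w_0 > 0`, positive laws, idle cold levels:
  `t_mix(ε) ≤ ⌈(1/(h·ρ/4))·log((e·K + 1)/ε)⌉₊`, `ρ = (3/4)·(t/K)·(p·h + rr·t)/(h+2t)²`.

Reading (no numerics implied): the bound is `O((K(h+2t)²/(h·t·(p·h + rr·t)))·log(K/ε))`: for `t ≲ h` the order `(K/(p·t))·log(K/ε)` and for `t ≳ h` the order
`(K/(h·rr))·log(K/ε)`; against the conjectured law-free order `(K/(p·min{t, h}))·log(K/ε)` of OPEN-MATH item 1 (ii) this is sharp up to an absolute constant when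
redraws outpace swaps and up to the factor `p/rr ≥ 1` (the strength of the one-sided drift; `= O(1)` unless `rr ≪ μ_0(b)`) when swaps outpace redraws; in every regime it is
polynomial in `K` and free of the cold law's least mass.  Closing the remaining factor `p/rr` in the strong-drift, fast-swap corner is what the Huber-excess potential of
S7/the memo (§9–§15) is designed for and is NOT claimed here.  NOT CLAIMED: anything measured; optimality.  Literature grade (cell rule): OWN, elementary; nothing cited as
a fact; no new bib keys.
-/

noncomputable section

namespace Summit.Ventures.LatticeQCDFlow.Scaling

/-! ## §1 How much a cold defect is worth: `D − u ≥ (3/4)·cD(h + rr·t)/(h+2t)²`, `D − v ≥ (3/4)·cD·rr·(h+t)/(h+2t)²` for the data `(D, D, D−1)` -/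

/-- The determinant of the class matrix `h·1 + L` expanded in `h`: `det = h³ + h²·tr L + h·E₂(L)` (no constant term: `L` has zero row sums), `tr L = c(N+D) +
c·rr·(G+1+D) + c(N + rr(G+1))`, `E₂(L)` the sum of the three principal `2×2` minors of `L`. [ours] -/
theorem threeState_det_expand {t h c G N D rr p1 p2 p3 det : ℝ} (ht : t = c * (G + N + D))
    (hp1 : p1 = t + h - c * G) (hp2 : p2 = t + h - c * ((G + 1) * (1 - rr) + (N - 1) + D * (1 - rr)))
    (hp3 : p3 = t + h - c * ((G + 1) * (1 - rr) + (D - 1)))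
    (hdet : det = p1 * (p2 * p3 - (c * D * rr) * (c * N)) - c ^ 2 * N * (G + 1) * rr * (p3 + c * D * rr)
      - c ^ 2 * D * (G + 1) * rr * (c * N + p2)) :
    det = h ^ 3 + h ^ 2 * (c * (N + D) + c * rr * (G + 1 + D) + c * (N + rr * (G + 1)))
      + h * ((c * (N + D)) * (c * rr * (G + 1 + D)) - (c * N) * (c * (G + 1) * rr)
        + ((c * (N + D)) * (c * (N + rr * (G + 1))) - (c * D) * (c * (G + 1) * rr))
        + ((c * rr * (G + 1 + D)) * (c * (N + rr * (G + 1))) - (c * D * rr) * (c * N))) := by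
  rw [hdet, hp1, hp2, hp3, ht]; ring

/-- **`3·det ≤ 4h·(h + t + c)²`**: `tr L ≤ 2(t + c)` (`rr ≤ 1`, `G ≥ −1`) and `E₂(L) ≤ (tr L)²/3` (the off-diagonal products are `≥ 0`; three-term AM–GM). [ours] -/
theorem threeState_det_le_sharp {t h c G N D rr p1 p2 p3 det : ℝ} (ht : t = c * (G + N + D)) (ht0 : 0 ≤ t) (hh : 0 < h) (hc : 0 ≤ c)
    (hG : 0 ≤ G + 1) (hN : 0 ≤ N) (hD : 0 ≤ D) (hrr0 : 0 ≤ rr) (hrr1 : rr ≤ 1)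
    (hp1 : p1 = t + h - c * G) (hp2 : p2 = t + h - c * ((G + 1) * (1 - rr) + (N - 1) + D * (1 - rr)))
    (hp3 : p3 = t + h - c * ((G + 1) * (1 - rr) + (D - 1)))
    (hdet : det = p1 * (p2 * p3 - (c * D * rr) * (c * N)) - c ^ 2 * N * (G + 1) * rr * (p3 + c * D * rr)
      - c ^ 2 * D * (G + 1) * rr * (c * N + p2)) :
    3 * det ≤ 4 * h * (h + t + c) ^ 2 := by
  have hexp := threeState_det_expand ht hp1 hp2 hp3 hdet
  -- the trace bound `tr L ≤ 2(t + c)`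
  have hT : c * (N + D) + c * rr * (G + 1 + D) + c * (N + rr * (G + 1)) ≤ 2 * (t + c) := by
    have f1 : rr * (G + 1 + D) ≤ G + 1 + D := mul_le_of_le_one_left (by linarith) hrr1
    have f2 : rr * (G + 1) ≤ G + 1 := mul_le_of_le_one_left hG hrr1
    have g1 : c * (rr * (G + 1 + D)) ≤ c * (G + 1 + D) := mul_le_mul_of_nonneg_left f1 hc
    have g2 : c * (rr * (G + 1)) ≤ c * (G + 1) := mul_le_mul_of_nonneg_left f2 hc
    have e : 2 * (t + c) = c * (N + D) + c * (G + 1 + D) + (c * N + c * (G + 1)) := by rw [ht]; ring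
    have e1 : c * rr * (G + 1 + D) = c * (rr * (G + 1 + D)) := by ring
    have e2 : c * (N + rr * (G + 1)) = c * N + c * (rr * (G + 1)) := by ring
    linarith only [g1, g2, e, e1, e2]
  generalize eG1 : G + 1 = G1 at hG hexp hT
  set a1 := c * (N + D) with ha1
  set a2 := c * rr * (G1 + D) with ha2
  set a3 := c * (N + rr * G1) with ha3
  have h1 : 0 ≤ a1 := by positivity
  have h2 : 0 ≤ a2 := by positivity
  have h3 : 0 ≤ a3 := by positivity
  have hT0 : 0 ≤ a1 + a2 + a3 := by positivity
  have htc : 0 ≤ t + c := by positivity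
  -- `E₂ ≤ a1a2 + a1a3 + a2a3 ≤ (a1+a2+a3)²/3`
  have o1 : 0 ≤ (c * N) * (c * G1 * rr) := by positivity
  have o2 : 0 ≤ (c * D) * (c * G1 * rr) := by positivity
  have o3 : 0 ≤ (c * D * rr) * (c * N) := by positivity
  have am : 3 * (a1 * a2 + a1 * a3 + a2 * a3) ≤ (a1 + a2 + a3) ^ 2 := by
    nlinarith only [sq_nonneg (a1 - a2), sq_nonneg (a1 - a3), sq_nonneg (a2 - a3)]
  have hE : 3 * (a1 * a2 - (c * N) * (c * G1 * rr) + (a1 * a3 - (c * D) * (c * G1 * rr)) + (a2 * a3 - (c * D * rr) * (c * N)))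
      ≤ (2 * (t + c)) ^ 2 := by
    have := pow_le_pow_left₀ hT0 hT 2
    linarith only [o1, o2, o3, am, this]
  have k1 := mul_le_mul_of_nonneg_left hE hh.le
  have k2 := mul_le_mul_of_nonneg_left hT (show 0 ≤ 3 * h ^ 2 by positivity)
  have k3 : 0 ≤ h ^ 2 * (t + c) := by positivity
  have k4 : 0 ≤ h ^ 3 := by positivity
  have e4 : 4 * h * (h + t + c) ^ 2 = 4 * h ^ 3 + 8 * (h ^ 2 * (t + c)) + h * (2 * (t + c)) ^ 2 := by ring
  rw [hexp, e4]
  linarith only [k1, k2, k3, k4]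

/-- **THE DEFECT GAIN.**  For a class with data `ψu = ψv = X`, `ψw = X − 1` (the potential `D·𝟙{D≥1}` at the three states, `X = D`), the values satisfy
`X − u = h·C₁₃/det`, `X − v = h·C₂₃/det` with `C₁₃ = cD(h + rr(t+c))`, `C₂₃ = cD·rr·(h+t+c)`; with `3det ≤ 4h(h+2t)²`:
**`X − u ≥ (3/4)·cD(h + rr·t)/(h+2t)²`, `X − v ≥ (3/4)·cD·rr·(h+t)/(h+2t)²`** (`t = c(G+N+D) ≥ 0`, `c ≤ t`, `h > 0`, `G ≥ −1`, `0 ≤ rr ≤ 1`). [ours] -/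
theorem threeState_defect_gain {t h c G N D rr X p1 p2 p3 det detu detv u v : ℝ} (ht : t = c * (G + N + D)) (ht0 : 0 ≤ t)
    (hh : 0 < h) (hc : 0 ≤ c) (hct : c ≤ t) (hG : 0 ≤ G + 1) (hN : 0 ≤ N) (hD : 0 ≤ D) (hrr0 : 0 ≤ rr) (hrr1 : rr ≤ 1)
    (hp1 : p1 = t + h - c * G) (hp2 : p2 = t + h - c * ((G + 1) * (1 - rr) + (N - 1) + D * (1 - rr)))
    (hp3 : p3 = t + h - c * ((G + 1) * (1 - rr) + (D - 1)))
    (hdet : det = p1 * (p2 * p3 - (c * D * rr) * (c * N)) - c ^ 2 * N * (G + 1) * rr * (p3 + c * D * rr)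
      - c ^ 2 * D * (G + 1) * rr * (c * N + p2))
    (hdetu : detu = h * X * (p2 * p3 - (c * D * rr) * (c * N)) + h * X * (c * N * (p3 + c * D)) + h * (X - 1) * (c * D * (c * N * rr + p2)))
    (hdetv : detv = h * X * (p1 * p3 - c ^ 2 * D * (G + 1) * rr) + h * X * (c * (G + 1) * rr * (p3 + c * D * rr))
      + h * (X - 1) * (c * D * rr * (p1 + c * (G + 1))))
    (hu : u = detu / det) (hv : v = detv / det) :
    3 * c * D * (h + rr * t) / (4 * (h + 2 * t) ^ 2) ≤ X - u ∧ 3 * c * D * rr * (h + t) / (4 * (h + 2 * t) ^ 2) ≤ X - v := by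
  have hdetpos := (threeState_det_pos ht hh hc hG hN hD hrr0 hp1 hp2 hp3 hdet).2
  have hdet3 := threeState_det_le_sharp ht ht0 hh hc hG hN hD hrr0 hrr1 hp1 hp2 hp3 hdet
  obtain ⟨r1, r2, -⟩ := threeState_rowsum ht hp1 hp2 hp3 hdet
  -- the third-column cofactors
  have i13 : c * D * (c * N * rr + p2) = c * D * (h + rr * (t + c)) := by rw [hp2, ht]; ring
  have i23 : c * D * rr * (p1 + c * (G + 1)) = c * D * rr * (h + t + c) := by rw [hp1]; ring
  have hS : 0 < 4 * (h + 2 * t) ^ 2 := by positivity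
  have hB : 3 * det ≤ 4 * h * (h + 2 * t) ^ 2 := by
    have l1 : h + t + c ≤ h + 2 * t := by linarith
    have l0 : 0 ≤ h + t + c := by linarith
    have := pow_le_pow_left₀ l0 l1 2
    have := mul_le_mul_of_nonneg_left this (show 0 ≤ 4 * h by positivity)
    linarith only [hdet3, this]
  have hB0 : 0 ≤ 4 * h * (h + 2 * t) ^ 2 := by positivity
  -- `X − u = h·C₁₃/det`, `X − v = h·C₂₃/det`
  have eu : X - u = h * (c * D * (c * N * rr + p2)) / det := by
    rw [hu, eq_div_iff hdetpos.ne', sub_mul, div_mul_cancel₀ _ hdetpos.ne', hdetu, ← r1]; ring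
  have ev : X - v = h * (c * D * rr * (p1 + c * (G + 1))) / det := by
    rw [hv, eq_div_iff hdetpos.ne', sub_mul, div_mul_cancel₀ _ hdetpos.ne', hdetv, ← r2]; ring
  rw [i13] at eu
  rw [i23] at ev
  rw [eu, ev, div_le_div_iff₀ hS hdetpos, div_le_div_iff₀ hS hdetpos]
  constructor
  · have n0 : 0 ≤ c * D * (h + rr * t) := by positivity
    have k1 : c * D * (h + rr * t) * (3 * det) ≤ c * D * (h + rr * t) * (4 * h * (h + 2 * t) ^ 2) :=
      mul_le_mul_of_nonneg_left hB n0
    have k2 : c * D * (h + rr * t) ≤ c * D * (h + rr * (t + c)) := by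
      have : 0 ≤ c * D * (rr * c) := by positivity
      rw [show c * D * (h + rr * (t + c)) = c * D * (h + rr * t) + c * D * (rr * c) by ring]; linarith only [this]
    have k3 := mul_le_mul_of_nonneg_right k2 hB0
    calc 3 * c * D * (h + rr * t) * det = c * D * (h + rr * t) * (3 * det) := by ring
      _ ≤ c * D * (h + rr * t) * (4 * h * (h + 2 * t) ^ 2) := k1
      _ ≤ c * D * (h + rr * (t + c)) * (4 * h * (h + 2 * t) ^ 2) := k3
      _ = h * (c * D * (h + rr * (t + c))) * (4 * (h + 2 * t) ^ 2) := by ring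
  · have ht' : 0 ≤ h + t := by linarith
    have n0 : 0 ≤ c * D * rr * (h + t) := by positivity
    have k1 : c * D * rr * (h + t) * (3 * det) ≤ c * D * rr * (h + t) * (4 * h * (h + 2 * t) ^ 2) :=
      mul_le_mul_of_nonneg_left hB n0
    have k2 : c * D * rr * (h + t) ≤ c * D * rr * (h + t + c) := by
      have : 0 ≤ c * D * rr * c := by positivity
      rw [show c * D * rr * (h + t + c) = c * D * rr * (h + t) + c * D * rr * c by ring]; linarith only [this]
    have k3 := mul_le_mul_of_nonneg_right k2 hB0
    calc 3 * c * D * rr * (h + t) * det = c * D * rr * (h + t) * (3 * det) := by ring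
      _ ≤ c * D * rr * (h + t) * (4 * h * (h + 2 * t) ^ 2) := k1
      _ ≤ c * D * rr * (h + t + c) * (4 * h * (h + 2 * t) ^ 2) := k3
      _ = h * (c * D * rr * (h + t + c)) * (4 * (h + 2 * t) ^ 2) := by ring


/-! ## §2 The all-`K` law with the plain defect count `Ψ = D·𝟙{D ≥ 1}` -/

section Law
open Finset Function Matrix
open Literature.Probability.MarkovChains

variable {K m : ℕ} {μ : Fin (K + 1) → Bool → ℝ} {M : Fin (K + 1) → Bool → Bool → ℝ} {w : Fin (K + 1) → ℝ} {t : ℝ}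
variable (κ : Fin m → Fin K) {cnt : (Fin (K + 1) → Bool) × (Fin (K + 1) → Bool) → Bool → Bool → ℝ}

omit κ in
/-- **THE REDRAW CONTRACTION FOR `Ψ = D·𝟙{D≥1}`:** with `U, V` the exact class values for this potential, at every configuration
`μ_0(b)·U(D,N) + μ_0(b̄)·V(D,N) ≤ (1 − ρ)·Ψ(D,N)` with `ρ = (3/4)·(t/K)·(p·h + rr·t)/(h+2t)²`, `h = (1−t)w_0`, `p = μ_0(b) + μ_0(b̄)·rr`. [ours] -/
theorem boolStar_defectCount_contr (ht0 : 0 < t) (ht1 : t < 1) (hw00 : 0 < w 0) (hμ : ∀ k x, 0 < μ k x) (hμ1 : ∀ k, ∑ u, μ k u = 1)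
    (hK1 : (1 : ℝ) ≤ K) {b : Bool} (hb : μ 0 b * μ 1 (!b) ≤ μ 0 (!b) * μ 1 b) {rr : ℝ} (hrr : rr = μ 0 b * μ 1 (!b) / (μ 0 (!b) * μ 1 b))
    (hcnt : ∀ a s t, cnt a s t = ((univ.filter fun i : Fin K => a.1 i.succ = s ∧ a.2 i.succ = t).card : ℝ))
    {Dc Nc : (Bool → Bool → ℝ) → ℝ} (hD : ∀ c, Dc c = c b (!b) + c (!b) b) (hN : ∀ c, Nc c = c (!b) (!b))
    {Ψa : ℝ → ℝ → ℝ} (hΨ : ∀ D N, Ψa D N = if 1 ≤ D then D + (fun _ : ℝ => (0 : ℝ)) N + (fun _ : ℝ => (0 : ℝ)) (N + D) else 0)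
    {p1 p2 p3 det detu detv : ℝ → ℝ → ℝ → ℝ}
    (hp1 : ∀ G N D, p1 G N D = t + (1 - t) * w 0 - t / K * G)
    (hp2 : ∀ G N D, p2 G N D = t + (1 - t) * w 0 - t / K * ((G + 1) * (1 - rr) + (N - 1) + D * (1 - rr)))
    (hp3 : ∀ G N D, p3 G N D = t + (1 - t) * w 0 - t / K * ((G + 1) * (1 - rr) + (D - 1)))
    (hdet : ∀ G N D, det G N D = p1 G N D * (p2 G N D * p3 G N D - (t / K * D * rr) * (t / K * N))
      - (t / K) ^ 2 * N * (G + 1) * rr * (p3 G N D + t / K * D * rr) - (t / K) ^ 2 * D * (G + 1) * rr * (t / K * N + p2 G N D))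
    (hdetu : ∀ G N D, detu G N D = (1 - t) * w 0 * Ψa D N * (p2 G N D * p3 G N D - (t / K * D * rr) * (t / K * N))
      + (1 - t) * w 0 * Ψa D (N - 1) * (t / K * N * (p3 G N D + t / K * D)) + (1 - t) * w 0 * Ψa (D - 1) N * (t / K * D * (t / K * N * rr + p2 G N D)))
    (hdetv : ∀ G N D, detv G N D = (1 - t) * w 0 * Ψa D (N - 1) * (p1 G N D * p3 G N D - (t / K) ^ 2 * D * (G + 1) * rr)
      + (1 - t) * w 0 * Ψa D N * (t / K * (G + 1) * rr * (p3 G N D + t / K * D * rr))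
      + (1 - t) * w 0 * Ψa (D - 1) N * (t / K * D * rr * (p1 G N D + t / K * (G + 1))))
    {U V : ℝ → ℝ → ℝ}
    (hU : ∀ D N, U D N = detu (K - D - N) N D / det (K - D - N) N D)
    (hV : ∀ D N, V D N = detv (K - D - N - 1) (N + 1) D / det (K - D - N - 1) (N + 1) D)
    (a : (Fin (K + 1) → Bool) × (Fin (K + 1) → Bool)) :
    μ 0 b * U (Dc (cnt a)) (Nc (cnt a)) + μ 0 (!b) * V (Dc (cnt a)) (Nc (cnt a))
      ≤ (1 - 3 / 4 * (t / K) * ((μ 0 b + μ 0 (!b) * rr) * ((1 - t) * w 0) + rr * t) / ((1 - t) * w 0 + 2 * t) ^ 2)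
        * Ψa (Dc (cnt a)) (Nc (cnt a)) := by
  have hΨ' : ∀ D N, Ψa D N = if 1 ≤ D then D else 0 := fun D N => by rw [hΨ]; simp
  have hh : 0 < (1 - t) * w 0 := mul_pos (by linarith) hw00
  have hc : 0 ≤ t / K := div_nonneg ht0.le (by linarith)
  have hct : t / K ≤ t := div_le_self ht0.le hK1
  obtain ⟨-, hrr0, hrr1⟩ := boolStar_acc_disliked (acc := fun u v => min 1 (μ 0 v * μ 1 u / (μ 0 u * μ 1 v))) hμ (fun u v => rfl) hb hrr
  have hc0 : ∀ s t', 0 ≤ cnt a s t' := fun s t' => by rw [hcnt]; exact Nat.cast_nonneg _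
  have htot := boolStar_cnt_total hcnt b a
  have hG : (K : ℝ) - Dc (cnt a) - Nc (cnt a) = cnt a b b := by rw [hD, hN]; linarith
  have hμb : μ 0 b + μ 0 (!b) = 1 := by have := hμ1 0; rw [Fintype.sum_bool] at this; cases b <;> simp at this ⊢ <;> linarith
  have hμ0 : 0 ≤ μ 0 b := (hμ 0 b).le
  have hμ0' : 0 ≤ μ 0 (!b) := (hμ 0 (!b)).le
  obtain ⟨n, hn⟩ := (boolStar_Dc_natCast hcnt hD a).1
  set D := Dc (cnt a) with hDdef
  set N := Nc (cnt a) with hNdef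
  have hN0 : 0 ≤ N := by rw [hNdef, hN]; exact hc0 _ _
  have hcK : ∀ G N' D' : ℝ, G + N' + D' = K → t = t / K * (G + N' + D') := fun G N' D' e => by rw [e]; field_simp
  rcases Nat.eq_zero_or_pos n with h0 | hpos
  · -- `D = 0`: the potential and both values vanish
    have hD0 : D = 0 := by rw [hn, h0]; simp
    have z1 : Ψa D N = 0 := by rw [hΨ', if_neg (by rw [hD0]; norm_num)]
    have z2 : Ψa D (N - 1) = 0 := by rw [hΨ', if_neg (by rw [hD0]; norm_num)]
    have z3 : Ψa (D - 1) N = 0 := by rw [hΨ', if_neg (by rw [hD0]; norm_num)]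
    have z4 : Ψa D (N + 1) = 0 := by rw [hΨ', if_neg (by rw [hD0]; norm_num)]
    have z5 : Ψa (D - 1) (N + 1) = 0 := by rw [hΨ', if_neg (by rw [hD0]; norm_num)]
    rw [hU, hV, hdetu, hdetv, show N + 1 - 1 = N by ring]
    simp [z1, z2, z3, z4, z5]
  · -- `D ≥ 1`: the data are `(D, D, D−1)` for both classes
    have hD1 : 1 ≤ D := by rw [hn]; exact_mod_cast hpos
    have eW : Ψa (D - 1) N = D - 1 ∧ Ψa (D - 1) (N + 1) = D - 1 := by
      rcases Nat.lt_or_ge n 2 with hlt | hge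
      · have hn1 : n = 1 := by omega
        have : D = 1 := by rw [hn, hn1]; simp
        rw [hΨ', hΨ', if_neg (by rw [this]; norm_num), this]; norm_num
      · have h2 : (2 : ℝ) ≤ n := by exact_mod_cast hge
        have : (1 : ℝ) ≤ D - 1 := by rw [hn]; linarith
        rw [hΨ', hΨ', if_pos this]; exact ⟨rfl, rfl⟩
    have e0 : Ψa D N = D := by rw [hΨ', if_pos hD1]
    have e1 : Ψa D (N - 1) = D := by rw [hΨ', if_pos hD1]
    have e2 : Ψa D (N + 1) = D := by rw [hΨ', if_pos hD1]
    -- class of `U(D,N)`: `(G, N, D)`, `G = cnt(b,b)`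
    have hGND : cnt a b b + N + D = K := by linarith [hG]
    have hu1 := hdetu (cnt a b b) N D
    have hv1 := hdetv (cnt a b b) N D
    rw [e0, e1, eW.1] at hu1 hv1
    have g1 := (threeState_defect_gain (X := D) (hcK _ _ _ hGND) ht0.le hh hc hct (by linarith [hc0 b b]) hN0 (by linarith) hrr0 hrr1
      (hp1 _ _ _) (hp2 _ _ _) (hp3 _ _ _) (hdet _ _ _) hu1 hv1 rfl rfl).1
    -- class of `V(D,N)`: `(G−1, N+1, D)`
    have hGND' : (cnt a b b - 1) + (N + 1) + D = K := by linarith [hG]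
    have hu2 := hdetu (cnt a b b - 1) (N + 1) D
    have hv2 := hdetv (cnt a b b - 1) (N + 1) D
    rw [show N + 1 - 1 = N by ring, e2, e0, eW.2] at hu2 hv2
    have g2 := (threeState_defect_gain (X := D) (hcK _ _ _ hGND') ht0.le hh hc hct (by linarith [hc0 b b]) (by linarith) (by linarith) hrr0 hrr1
      (hp1 _ _ _) (hp2 _ _ _) (hp3 _ _ _) (hdet _ _ _) hu2 hv2 rfl rfl).2
    rw [hU, hV, hG, e0]
    -- assemble: `μ(D − U) + μ̄(D − V) ≥ (μ + μ̄·rr)·h·c·D/(h+2t)²`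
    set u := detu (cnt a b b) N D / det (cnt a b b) N D with hudef
    set v := detv (cnt a b b - 1) (N + 1) D / det (cnt a b b - 1) (N + 1) D with hvdef
    have k1 := mul_le_mul_of_nonneg_left g1 hμ0
    have k2 := mul_le_mul_of_nonneg_left g2 hμ0'
    have e : (1 - 3 / 4 * (t / K) * ((μ 0 b + μ 0 (!b) * rr) * ((1 - t) * w 0) + rr * t) / ((1 - t) * w 0 + 2 * t) ^ 2) * D
        = (μ 0 b + μ 0 (!b)) * D - (μ 0 b * (3 * (t / K) * D * ((1 - t) * w 0 + rr * t) / (4 * ((1 - t) * w 0 + 2 * t) ^ 2))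
          + μ 0 (!b) * (3 * (t / K) * D * rr * ((1 - t) * w 0 + t) / (4 * ((1 - t) * w 0 + 2 * t) ^ 2))) := by
      have hμb' : μ 0 (!b) = 1 - μ 0 b := by linarith only [hμb]
      have hSne : (1 - t) * w 0 + 2 * t ≠ 0 := by have := mul_pos (show (0 : ℝ) < 1 - t by linarith) hw00; linarith
      rw [hμb']; field_simp; ring
    rw [e]
    linarith

/-- **THE COLD-START LAW OF THE HOMOGENEOUS BOOLEAN STAR, ALL `K`, THROUGH THE CERTIFICATE ROUTE.**  Persistent hub with `K` cold levels, contents `Bool`, identity maps,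
homogeneous cold law, uniform entry list (`c` entries per level, `m ≥ 1`), idle cold levels, exact hot redraws at weight `w_0 > 0`, swap rate `0 < t < 1`, liked content `b`
(`μ_0(b)μ_1(b̄) ≤ μ_0(b̄)μ_1(b)`), `p = μ_0(b) + μ_0(b̄)·rr` the one-sided domination constant, `h = (1−t)w_0`:
**`t_mix(ε) ≤ ⌈(4/(h·ρ))·log((e·K + 1)/ε)⌉₊` with `ρ = (3/4)·(t/K)·(p·h + rr·t)/(h + 2t)²`**, i.e. `t_mix = O((K(h+2t)²/(h·t·(p·h + rr·t)))·log(K/ε))`: for `t ≲ h`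
the order `(K/(p·t))·log(K/ε)`, for `t ≳ h` the order `(K/(h·rr))·log(K/ε)` — the conjectured law-free order `(K/(p·min{t,h}))·log(K/ε)` of OPEN-MATH item 1 up to an
absolute constant in the first regime and up to the factor `p/rr ∈ [1, ∞)` (the strength of the one-sided drift) in the second; polynomial in `K`, free of `|S|` and of the
cold law's least mass in general. [ours] -/
theorem boolStar_mixingTime_le_allK (hm : 1 ≤ m) (ht0 : 0 < t) (ht1 : t < 1) (hw0 : ∀ k, 0 ≤ w k) (hw00 : 0 < w 0)
    (hw1 : ∑ k, w k = 1) (hμ : ∀ k x, 0 < μ k x) (hμ1 : ∀ k, ∑ u, μ k u = 1) (hM0 : ∀ u v, M 0 u v = μ 0 v)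
    (hidle : ∀ i : Fin K, ∀ u v, M i.succ u v = if v = u then 1 else 0) (hhom : ∀ i : Fin K, μ i.succ = μ 1)
    {c0 : ℕ} (hunif : ∀ i : Fin K, (univ.filter fun r : Fin m => κ r = i).card = c0)
    {b : Bool} (hb : μ 0 b * μ 1 (!b) ≤ μ 0 (!b) * μ 1 b) {ε : ℝ} (hε : 0 < ε) :
    mixingTime (fun y z : Fin (K + 1) → Bool =>
        t * ptGraphSwap μ (fun r : Fin m => (((0 : Fin (K + 1)), (κ r).succ) : Fin (K + 1) × Fin (K + 1))) (fun _ : Fin m => Equiv.refl Bool) y z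
          + (1 - t) * prodKernel w M y z) (tensorFun μ) ε
      ≤ ⌈1 / ((1 - t) * w 0 * (3 / 4 * (t / K) * ((μ 0 b + μ 0 (!b) * (μ 0 b * μ 1 (!b) / (μ 0 (!b) * μ 1 b))) * ((1 - t) * w 0)
          + μ 0 b * μ 1 (!b) / (μ 0 (!b) * μ 1 b) * t) / ((1 - t) * w 0 + 2 * t) ^ 2) / 4) * Real.log ((Real.exp 1 * K + 1) / ε)⌉₊ := by
  let rr : ℝ := μ 0 b * μ 1 (!b) / (μ 0 (!b) * μ 1 b)
  let ρ : ℝ := 3 / 4 * (t / K) * ((μ 0 b + μ 0 (!b) * rr) * ((1 - t) * w 0) + rr * t) / ((1 - t) * w 0 + 2 * t) ^ 2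
  let φ : ℝ → ℝ := fun _ => 0
  let Ψa : ℝ → ℝ → ℝ := fun D N => if 1 ≤ D then D + φ N + φ (N + D) else 0
  let cnt : (Fin (K + 1) → Bool) × (Fin (K + 1) → Bool) → Bool → Bool → ℝ :=
    fun a s t' => ((univ.filter fun i : Fin K => a.1 i.succ = s ∧ a.2 i.succ = t').card : ℝ)
  let Dc : (Bool → Bool → ℝ) → ℝ := fun c => c b (!b) + c (!b) b
  let Nc : (Bool → Bool → ℝ) → ℝ := fun c => c (!b) (!b)
  let hh : ℝ := (1 - t) * w 0
  let c : ℝ := t / K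
  let p1 : ℝ → ℝ → ℝ → ℝ := fun G N D => t + hh - c * G
  let p2 : ℝ → ℝ → ℝ → ℝ := fun G N D => t + hh - c * ((G + 1) * (1 - rr) + (N - 1) + D * (1 - rr))
  let p3 : ℝ → ℝ → ℝ → ℝ := fun G N D => t + hh - c * ((G + 1) * (1 - rr) + (D - 1))
  let det : ℝ → ℝ → ℝ → ℝ := fun G N D => p1 G N D * (p2 G N D * p3 G N D - (c * D * rr) * (c * N))
      - c ^ 2 * N * (G + 1) * rr * (p3 G N D + c * D * rr) - c ^ 2 * D * (G + 1) * rr * (c * N + p2 G N D)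
  let detu : ℝ → ℝ → ℝ → ℝ := fun G N D => hh * Ψa D N * (p2 G N D * p3 G N D - (c * D * rr) * (c * N))
      + hh * Ψa D (N - 1) * (c * N * (p3 G N D + c * D)) + hh * Ψa (D - 1) N * (c * D * (c * N * rr + p2 G N D))
  let detv : ℝ → ℝ → ℝ → ℝ := fun G N D => hh * Ψa D (N - 1) * (p1 G N D * p3 G N D - c ^ 2 * D * (G + 1) * rr)
      + hh * Ψa D N * (c * (G + 1) * rr * (p3 G N D + c * D * rr)) + hh * Ψa (D - 1) N * (c * D * rr * (p1 G N D + c * (G + 1)))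
  let detw : ℝ → ℝ → ℝ → ℝ := fun G N D => hh * Ψa (D - 1) N * (p1 G N D * p2 G N D - c ^ 2 * N * (G + 1) * rr)
      + hh * Ψa D (N - 1) * (c * N * (p1 G N D + c * (G + 1) * rr)) + hh * Ψa D N * (c * (G + 1) * rr * (c * N + p2 G N D))
  let U : ℝ → ℝ → ℝ := fun D N => detu (K - D - N) N D / det (K - D - N) N D
  let V : ℝ → ℝ → ℝ := fun D N => detv (K - D - N - 1) (N + 1) D / det (K - D - N - 1) (N + 1) D
  let Wf : ℝ → ℝ → ℝ := fun D N => detw (K - D - N - 1) N (D + 1) / det (K - D - N - 1) N (D + 1)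
  -- `K ≥ 1`, `0 < ρ ≤ 1`
  have hmK : (m : ℝ) = c0 * K := uniformList_card κ hunif
  have hK1 : (1 : ℝ) ≤ K := by
    have hK0 : K ≠ 0 := by
      intro h0; have : (m : ℝ) = 0 := by rw [hmK, h0]; simp
      exact absurd (by exact_mod_cast this : m = 0) (by omega)
    exact_mod_cast Nat.one_le_iff_ne_zero.mpr hK0
  obtain ⟨-, hrr0, hrr1⟩ := boolStar_acc_disliked (acc := fun u v => min 1 (μ 0 v * μ 1 u / (μ 0 u * μ 1 v))) hμ (fun u v => rfl) hb (rr := rr) rfl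
  have hμb : μ 0 b + μ 0 (!b) = 1 := by have := hμ1 0; rw [Fintype.sum_bool] at this; cases b <;> simp at this ⊢ <;> linarith
  have hp0 : 0 < μ 0 b + μ 0 (!b) * rr := by nlinarith [hμ 0 b, hμ 0 (!b)]
  have hp1' : μ 0 b + μ 0 (!b) * rr ≤ 1 := by nlinarith [hμ 0 (!b)]
  have hh0 : 0 < (1 - t) * w 0 := mul_pos (by linarith) hw00
  have hc0 : 0 < t / K := div_pos ht0 (by linarith)
  have hS : 0 < ((1 - t) * w 0 + 2 * t) ^ 2 := by positivity
  have hnum : 0 < (μ 0 b + μ 0 (!b) * rr) * ((1 - t) * w 0) + rr * t := by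
    have := mul_pos hp0 hh0; have := mul_nonneg hrr0 ht0.le; linarith
  have hρ0 : 0 < ρ := div_pos (mul_pos (mul_pos (by norm_num) hc0) hnum) hS
  have hρ1 : ρ ≤ 1 := by
    show 3 / 4 * (t / K) * ((μ 0 b + μ 0 (!b) * rr) * ((1 - t) * w 0) + rr * t) / ((1 - t) * w 0 + 2 * t) ^ 2 ≤ 1
    rw [div_le_one hS]
    have q1 := mul_le_mul_of_nonneg_right hp1' hh0.le
    have q2 := mul_le_mul_of_nonneg_right hrr1 ht0.le
    have q3 : 3 / 4 * (t / K) * ((μ 0 b + μ 0 (!b) * rr) * ((1 - t) * w 0) + rr * t) ≤ 3 / 4 * t * ((1 - t) * w 0 + t) := by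
      have := div_le_self ht0.le hK1
      have : (μ 0 b + μ 0 (!b) * rr) * ((1 - t) * w 0) + rr * t ≤ (1 - t) * w 0 + t := by linarith
      gcongr
    nlinarith [mul_pos hh0 ht0, q3]
  have hφ0 : ∀ x, 0 ≤ φ x := fun _ => le_rfl
  have hφ : ∀ x y, |φ x - φ y| ≤ |x - y| := fun x y => by show |(0 : ℝ) - 0| ≤ |x - y|; simp
  refine boolStar_mixingTime_le_of_lipschitzPotential κ hm ht0.le ht1 hw0 hw00 hw1 hμ hμ1 hM0 hidle hhom hunif hb (rr := rr) rfl
    (cnt := cnt) (fun a s t' => rfl) (Dc := Dc) (Nc := Nc) (fun c => rfl) (fun c => rfl) hφ0 hφ (Ψa := Ψa) (fun D N => rfl) (Ψmax := K)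
    (p1 := p1) (p2 := p2) (p3 := p3) (det := det) (detu := detu) (detv := detv) (detw := detw)
    (fun G N D => rfl) (fun G N D => rfl) (fun G N D => rfl) (fun G N D => rfl) (fun G N D => rfl) (fun G N D => rfl) (fun G N D => rfl)
    (U := U) (V := V) (W := Wf) (fun D N => rfl) (fun D N => rfl) (fun D N => rfl) (fun a => ?_) hρ0 hρ1
    (fun a => boolStar_defectCount_contr ht0 ht1 hw00 hμ hμ1 hK1 hb (rr := rr) rfl (cnt := cnt) (fun a s t' => rfl) (Dc := Dc) (Nc := Nc)
      (fun c => rfl) (fun c => rfl) (Ψa := Ψa) (fun D N => rfl) (p1 := p1) (p2 := p2) (p3 := p3) (det := det) (detu := detu) (detv := detv)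
      (fun G N D => rfl) (fun G N D => rfl) (fun G N D => rfl) (fun G N D => rfl) (fun G N D => rfl) (fun G N D => rfl)
      (U := U) (V := V) (fun D N => rfl) (fun D N => rfl) a) hε
  -- `Ψa ≤ K` on configurations
  have hc0' : ∀ s t', (0 : ℝ) ≤ cnt a s t' := fun s t' => Nat.cast_nonneg _
  have htot := boolStar_cnt_total (cnt := cnt) (fun a s t' => rfl) b a
  show (if 1 ≤ Dc (cnt a) then Dc (cnt a) + φ (Nc (cnt a)) + φ (Nc (cnt a) + Dc (cnt a)) else 0) ≤ (K : ℝ)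
  split_ifs
  · show cnt a b (!b) + cnt a (!b) b + 0 + 0 ≤ (K : ℝ)
    linarith [hc0' b b, hc0' (!b) (!b)]
  · exact Nat.cast_nonneg K

end Law

end Summit.Ventures.LatticeQCDFlow.Scaling

end
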